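import Summits.AtomisticToContinuum.BoseEinsteinCondensation.Theorems.BECSwapNoCatastropheDefs
import HarnessLib

/-!
# Crux `TorusHalfSwapOverlap` (stmt-AtomisticToContinuum-14393), line `birth`, stub `stub_integrableSingularChord` (S1e)

Route `BECSwapNoCatastrophe` (sub-problem `BoseEinsteinCondensation`), lead c6 (2026-08-17). GLUE: rank 3
restated on the INTEGRABLE SINGULAR class (`v` unbounded on `[0, ∞)` with `∫_{ℝ³} v(|x|) dx < ∞`; the
registered open statement `stub_pathRigidityOfIntegrable`, taken here as a hypothesis verbatim) implies the
midpoint chord `TwoCopyTorus.MidpointChordAt v` for every such `v` (folded `TwoCopyTorus` vocabulary of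
`Theorems/BECSwapNoCatastropheDefs.lean`).

Proof. Exactly the bounded-class argument of `stub_chordOfPath` (Theorems/…ChordOfPath.lean): take the
hypothesis at `ε = 1`, its `ρ₀`, `η = ⅛`; eventually in `n` the abstract chord lemma `ChordOfPath.glue`
(instance `(s, s′) = (½, 0)`, `τ = ⅛`, `1 − 1·(½ − 0)² − ⅛ = ½ + ⅛`) applies once the endpoints of the
folded swap path are identified pointwise in `Θ`: `E2path v n L (1/2) Θ = E2half v n L Θ`
(`ChordOfPath.lintegral_half_eq` at `C2 := cell2 n L`, definitionally the folded statement) and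
`E2path v n L 0 Θ = E2zero v n L Θ` (`ChordOfPath.lintegral_zero_eq`, `kinetic2` unfolds to the two
kinetic summands). [folklore]
-/

noncomputable section

open MeasureTheory Filter
open scoped ENNReal NNReal BigOperators ComplexConjugate

namespace Summit.AtomisticToContinuum.BoseEinsteinCondensation.Cruxes.TorusHalfSwapOverlap.Birth

open Literature.MathematicalPhysics.QuantumManyBody.BoseGas

/-! ### Helper lemmas (inside `namespace IntegrableSingularChord … end IntegrableSingularChord`) -/

namespace IntegrableSingularChord

/-- **The midpoint of the folded swap path is the half-swapped form**: `E2path v n L (1/2) Θ = E2half v n L Θ`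
(`ChordOfPath.lintegral_half_eq` over the two-copy cell, read back definitionally). [folklore] -/
theorem E2path_half_eq (v : ℝ → ℝ≥0∞) {n : ℕ} (L : ℝ) (Θ : Config (n + 1) × Config (n + 1) → ℂ) :
    TwoCopyTorus.E2path v n L (1 / 2) Θ = TwoCopyTorus.E2half v n L Θ :=
  ChordOfPath.lintegral_half_eq v L (TwoCopyTorus.cell2 n L) Θ

/-- **The endpoint `s = 0` of the folded swap path is the uncoupled form**: `E2path v n L 0 Θ = E2zero v n L Θ`
(`ChordOfPath.lintegral_zero_eq` over the two-copy cell; `kinetic2` is the sum of the two kinetic densities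
by definition). [folklore] -/
theorem E2path_zero_eq (v : ℝ → ℝ≥0∞) {n : ℕ} (L : ℝ) (Θ : Config (n + 1) × Config (n + 1) → ℂ) :
    TwoCopyTorus.E2path v n L 0 Θ = TwoCopyTorus.E2zero v n L Θ :=
  ChordOfPath.lintegral_zero_eq v L (TwoCopyTorus.cell2 n L) Θ

end IntegrableSingularChord

/-! ### The registered stub -/

/-- **Rank 3 on the integrable singular class ⇒ the midpoint chord** (`stub_integrableSingularChord`, S1e,
registered signature): the `(s, s′) = (½, 0)`, `ε = 1`, `τ = ⅛` instance of the hypothesis, `η = ⅛`. [folklore] -/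
theorem stub_integrableSingularChord :
    (∀ v : ℝ → ℝ≥0∞, IsRepulsiveFiniteRange v → (¬ ∃ M : NNReal, ∀ r, 0 ≤ r → v r ≤ M) →
      (∫⁻ x : Space, v ‖x‖) < ⊤ → ∀ ε : ℝ, 0 < ε →
      ∃ ρ₀ : ℝ, 0 < ρ₀ ∧ ∀ ρ : ℝ, 0 < ρ → ρ < ρ₀ → ∀ᶠ n : ℕ in atTop,
        ∀ s : ℝ, 0 ≤ s → s ≤ 1 → ∀ s' : ℝ, 0 ≤ s' → s' ≤ 1 → ∀ τ : ℝ, 0 < τ → ∃ δ : ℝ≥0∞, 0 < δ ∧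
          ∀ Θ Θ' : Config (n + 1) × Config (n + 1) → ℂ,
            TwoCopyTorus.Adm0 n (sideLength ρ (n + 1)) Θ → TwoCopyTorus.Adm0 n (sideLength ρ (n + 1)) Θ' →
            TwoCopyTorus.E2path v n (sideLength ρ (n + 1)) s Θ ≤
              (⨅ (Θ'' : Config (n + 1) × Config (n + 1) → ℂ) (_ : TwoCopyTorus.Adm0 n (sideLength ρ (n + 1)) Θ''),
                TwoCopyTorus.E2path v n (sideLength ρ (n + 1)) s Θ'') + δ →
            TwoCopyTorus.E2path v n (sideLength ρ (n + 1)) s' Θ' ≤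
              (⨅ (Θ'' : Config (n + 1) × Config (n + 1) → ℂ) (_ : TwoCopyTorus.Adm0 n (sideLength ρ (n + 1)) Θ''),
                TwoCopyTorus.E2path v n (sideLength ρ (n + 1)) s' Θ'') + δ →
            ENNReal.ofReal (1 - ε * (s - s') ^ 2 - τ) ≤
              (‖∫ Z in TwoCopyTorus.cell2 n (sideLength ρ (n + 1)), (starRingEnd ℂ) (Θ Z) * Θ' Z‖₊ : ENNReal) ^ 2) →
    ∀ v : ℝ → ℝ≥0∞, IsRepulsiveFiniteRange v → (¬ ∃ M : NNReal, ∀ r, 0 ≤ r → v r ≤ M) →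
      (∫⁻ x : Space, v ‖x‖) < ⊤ → TwoCopyTorus.MidpointChordAt v := by
  intro hPR v hv hb hint
  obtain ⟨ρ₀, hρ₀, H⟩ := hPR v hv hb hint 1 one_pos
  refine ⟨ρ₀, hρ₀, fun ρ hρ hlt => ⟨1 / 8, by norm_num, ?_⟩⟩
  filter_upwards [H ρ hρ hlt] with n hn
  exact ChordOfPath.glue hn (IntegrableSingularChord.E2path_half_eq v (sideLength ρ (n + 1)))
    (IntegrableSingularChord.E2path_zero_eq v (sideLength ρ (n + 1)))

end Summit.AtomisticToContinuum.BoseEinsteinCondensation.Cruxes.TorusHalfSwapOverlap.Birth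

end
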